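import Summits.QuantumFields.YangMills.Theorems.BalabanUVNodesN07HessOpOfRecordPiFlat
import Literature.MathematicalPhysics.QuantumFieldTheory.Balaban1983to89.Node00.BgSchemeOfRecordEL
import HarnessLib

/-!
# NODE N07 — def-Y's SLICE TOKEN `FrakGSliceTok` («`Q𝔊 = 0`, `RD*𝔊 = 0`», [15] p. 294, ✓`Node00.BgSchemeOfRecordEL`) INHABITED BY NAME: at every guarded
# background for print's `G′` and any symmetric `Δ⁽²⁾` (modulo the displayed `hpos`, `hQ`), on [15] (2)'s class `𝔘_k` (modulo `hpos` alone), and on the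
# flat orbit at `Δ⁽²⁾ = 0` with NO displayed letter — the E2 witnesses of the (s2) file's hypothesis `h𝔊`

Cell `pub-ymgap`, width seat `pub-ymgap-dag-n07-w3` (g26), CLAIM-2.  `--kind proof --supports stmt-QuantumFields-27238 --as helper`; count-neutral.
[15] = [Balaban1985Variational]; [B9] = [Balaban1985BackgroundPropagators].

WHAT.  def-Y's (s2) `Node00/BgSchemeOfRecordEL.lean` (✓p821144) reads (109)∕(116) at the scheme of record under the DISPLAYED slice letter
`FrakGSliceTok F N K k Ω U₀ Gp Δ2 a hposπ hQ := ∀ f, frakGOfRecordAtBg128 … f ∈ constraint102OfRecord …` and names this lane for its Summit-side discharge.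
`constraint102OfRecord` is lit's `constraint102` at the record's letters VERBATIM (an `abbrev`), i.e. the very submodule ✓p819846
`N07HessOpOfRecordSymmetric.frakGOfRecordAtBg128_mem_constraint102` and ✓p820502 `N07HessOpOfRecordPiFlat.frakGOfRecordAtBg128_pureGauge_zero_mem_constraint102`
conclude in; this file is the three-line dictionary, plus the `HessSymmTok` form of the symmetry input (the token 3g′ states for the slot-(c) operator).
* `frakGSliceTok_of_gaugeModes` — every guarded `U₀` (`SmallBelow (avOfRecord F N K) k U₀`), `G′ := (T′)⁻¹` with `T′ = Δ_{U₀}` on `N(Q′♭)`, symmetric `Δ2`; modulo `hpos`, `hQ`.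
* `frakGSliceTok_of_hessSymmTok` — the same with the symmetry input read as 3g′'s `HessSymmTok Δ2` (`Δ2 = (Δ(U₀)+Δ2) − Δ(U₀)`, ✓`hessOpOfRecord_isSymmetric`).
* `frakGSliceTok_of_inUkClassB11` — on `𝔘_k({T}, ε₀)` (`hQ`, guard discharged); modulo `hpos` alone.
* `frakGSliceTok_pureGauge_zero` — at `U₀ = u • 1`, `Δ2 = 0`: NO displayed letter (E2 witness of the token).

HONEST LABELS.  By-name dictionary; no estimate; `hpos` ([B9] Thm 3.12) at a general guarded background stays displayed.  Count-neutral; N07 NOT discharged;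
P0 ⟨26900⟩ OPEN; R4 is the conditional finite-𝕋⁴ rung only.  Nothing here is a claim about the Yang–Mills mass gap (`Summit.QuantumFields`): finite torus,
fixed `ε`; nothing continuum ∕ OS ∕ Clay.
-/

set_option autoImplicit false

noncomputable section

open scoped Matrix Matrix.Norms.L2Operator InnerProductSpace ComplexConjugate

namespace Summit.QuantumFields.YangMills.Theorems.N07FrakGSliceTokOfRecord

open Literature.MathematicalPhysics.QuantumFieldTheory.Balaban1983to89
open Literature.MathematicalPhysics.QuantumFieldTheory.Balaban1983to89.T4Continuum (T4Family)
open T4Continuum BlockAveraging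
open B9SectCLatticeCarrier (Bond)
open B11Eq103H1Complex (SiteL2K BondL2K covLaplaceSiteK greenK)
open Node00
open GaugeField (gaugeAct)
open BlockAveragingEMLHaarAC (emlWeight)
open ExpMeanLog (deltaSU)
open Summit.QuantumFields.YangMills.Theorems.BlockAvgCorrector (stokesConst)
open Summit.QuantumFields.YangMills.Theorems.N07HessOpOfRecordSymmetric (hessOpOfRecord_isSymmetric frakGOfRecordAtBg128_mem_constraint102
  frakGOfRecordAtBg128_mem_constraint102_of_inUkClassB11)
open Summit.QuantumFields.YangMills.BalabanUVNodes.N07QOfRecordOntoSmallField (QOfRecord_surjective_of_inUkClassB11 QOfRecord_surjective_gaugeAct_one)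
open Summit.QuantumFields.YangMills.Theorems.N07HessOpOfRecordPiFlat (laplaceAOfRecordAt128_pureGauge_zero_pos frakGOfRecordAtBg128_pureGauge_zero_mem_constraint102)

variable (F : T4Family) (N : ℕ) [NeZero N] {K : ℕ} (k : ℕ) [Fact (0 < (F.L : ℝ))] [Fact (0 < (F.P K).eta k)] [Fact (0 < c0Rec F K k)]
  [Fact (∀ c, 0 < wBRec F K k c)] (Ω : ℕ → Set (Site (F.P K) 0))

/-! ## §1  Every guarded background, print's `G′`, symmetric `Δ⁽²⁾` -/

section Guarded

variable (U₀ : GaugeField (F.P K) 0 (SU N))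
  (T' : SiteL2K ℂ (F.P K).d (fun _ => (F.P K).sitesPerDir 0) (c0Rec F K k) (WRec N) →ₗ[ℂ] SiteL2K ℂ (F.P K).d (fun _ => (F.P K).sitesPerDir 0) (c0Rec F K k) (WRec N))
  (hpos' : ∀ x, x ≠ 0 → 0 < RCLike.re ⟪x, T' x⟫_ℂ)
  (hT' : ∀ l, QflatOfRecord F N k l = 0 → T' l = covLaplaceSiteK (cRec F K k) (RRec F N U₀) (SRec F N U₀) l)
  {Δ2 : BondL2K ℂ (F.P K).d (fun _ => (F.P K).sitesPerDir 0) (c0Rec F K k) (WRec N) →ₗ[ℂ]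
    BondL2K ℂ (F.P K).d (fun _ => (F.P K).sitesPerDir 0) (c0Rec F K k) (WRec N)} {a : ℝ}
  (hpos : ∀ x, x ≠ 0 → 0 < RCLike.re ⟪x, laplaceAOfRecordAt F N k U₀ (hessOpOfRecord128 F N k U₀ (greenK T' hpos') (QflatOfRecord F N k) Δ2)
      (QOfRecord F N k U₀) (QflatOfRecord F N k) a x⟫_ℂ)

include hT' in
/-- ★★ **`FrakGSliceTok` AT EVERY GUARDED BACKGROUND** for print's `G′ := (T′)⁻¹` (`T′` positive, `= Δ_{U₀}` on `N(Q′♭)`) and any symmetric datum `Δ⁽²⁾`, modulo the displayed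
`hpos` ([B9] Thm 3.12) and `hQ` — ✓`frakGOfRecordAtBg128_mem_constraint102` by name. [cite: Balaban1985Variational, (110)–(111) p.294, (117) p.295; Balaban1985BackgroundPropagators, (3.124) p.420] -/
theorem frakGSliceTok_of_gaugeModes (hΔ2 : Δ2.IsSymmetric) (hQ : Function.Surjective (QOfRecord F N k U₀)) (hguard : SmallBelow (avOfRecord F N K) k U₀) :
    FrakGSliceTok F N K k Ω U₀ (greenK T' hpos') Δ2 a hpos hQ :=
  fun f => frakGOfRecordAtBg128_mem_constraint102 F N k Ω U₀ T' hpos' hT' hΔ2 hpos hQ hguard f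

include hT' in
/-- ★★ **THE SAME WITH 3g′'s TOKEN `HessSymmTok Δ2` AS THE SYMMETRY INPUT** (`Δ⁽²⁾ = (Δ(U₀) + Δ⁽²⁾) − Δ(U₀)` is symmetric since `Δ(U₀)` is, ✓`hessOpOfRecord_isSymmetric`).
[cite: Balaban1985Variational, (110)–(111) p.294; Balaban1985BackgroundPropagators, (3.10) p.392, (3.128) p.421] -/
theorem frakGSliceTok_of_hessSymmTok (hΔ : HessSymmTok F N K k U₀ Δ2) (hQ : Function.Surjective (QOfRecord F N k U₀))
    (hguard : SmallBelow (avOfRecord F N K) k U₀) : FrakGSliceTok F N K k Ω U₀ (greenK T' hpos') Δ2 a hpos hQ := by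
  have hΔ2 : Δ2.IsSymmetric := by
    have h := hΔ.sub (hessOpOfRecord_isSymmetric F N k U₀)
    rwa [add_sub_cancel_left] at h
  exact frakGSliceTok_of_gaugeModes F N k Ω U₀ T' hpos' hT' hpos hΔ2 hQ hguard

include hT' in
/-- ★★ **`FrakGSliceTok` ON [15] (2)'s CLASS `𝔘_k({T}, ε₀)`** (`hQ` and the guard discharged; modulo `hpos` alone) — ✓`frakGOfRecordAtBg128_mem_constraint102_of_inUkClassB11`.
[cite: Balaban1985Variational, (2) p.278, (110)–(111) p.294, (117) p.295; Balaban1985Averaging, Prop. 2 p.26] -/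
theorem frakGSliceTok_of_inUkClassB11 (hΔ2 : Δ2.IsSymmetric) (hk : k ≤ (F.P K).m + (F.P K).K) {ε₀ : ℝ} (hε₀ : 0 < ε₀)
    (h3 : (143 * (((((F.P K).d + 4 : ℕ) : ℝ)) ^ 2 / 4) ^ 2) * ε₀ ≤ 1 / 3)
    (h2 : 2 * ε₀ ≤ 2 * deltaSU (Fin N) / ((((F.P K).d + 4) * (F.P K).L : ℕ) : ℝ) ^ 2)
    (hst : stokesConst (F.P K) * (2 * ε₀) < emlWeight (F.P K) / 16) (hstδ : stokesConst (F.P K) * (2 * ε₀) < deltaSU (Fin N))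
    (hU : InUkClassB11 F N K k ε₀ U₀) :
    FrakGSliceTok F N K k Ω U₀ (greenK T' hpos') Δ2 a hpos (QOfRecord_surjective_of_inUkClassB11 hk hε₀ h3 h2 hst hstδ hU) :=
  fun f => frakGOfRecordAtBg128_mem_constraint102_of_inUkClassB11 F N k Ω U₀ T' hpos' hT' hΔ2 hpos hk hε₀ h3 h2 hst hstδ hU f

end Guarded

/-! ## §2  E2: the flat orbit, `Δ⁽²⁾ = 0`, no displayed letter -/

set_option maxRecDepth 16384 in
/-- ★★★ **E2 — `FrakGSliceTok` AT `U₀ = u • 1`, `Δ⁽²⁾ = 0`, PRINT'S `G′`, WITH NO DISPLAYED LETTER** (`hposπ` := ✓`laplaceAOfRecordAt128_pureGauge_zero_pos`,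
`hQ` := ✓`QOfRecord_surjective_gaugeAct_one`; `0 < a`, `k ≤ m + K`) — ✓`frakGOfRecordAtBg128_pureGauge_zero_mem_constraint102` by name.
[cite: Balaban1985Variational, (102) p.293, (110)–(111) p.294, (117) p.295; Balaban1985BackgroundPropagators, (3.119) p.419, Thm 3.11 p.416] -/
theorem frakGSliceTok_pureGauge_zero (hk : k ≤ (F.P K).m + (F.P K).K) {a : ℝ} (ha : 0 < a) (u : GaugeTransf (F.P K) 0 (SU N))
    (T' : SiteL2K ℂ (F.P K).d (fun _ => (F.P K).sitesPerDir 0) (c0Rec F K k) (WRec N) →ₗ[ℂ] SiteL2K ℂ (F.P K).d (fun _ => (F.P K).sitesPerDir 0) (c0Rec F K k) (WRec N))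
    (hpos' : ∀ x, x ≠ 0 → 0 < RCLike.re ⟪x, T' x⟫_ℂ)
    (hT' : ∀ l, QflatOfRecord F N k l = 0 → T' l = covLaplaceSiteK (cRec F K k) (RRec F N (gaugeAct u 1)) (SRec F N (gaugeAct u 1)) l) :
    FrakGSliceTok F N K k Ω (gaugeAct u 1) (greenK T' hpos') 0 a (laplaceAOfRecordAt128_pureGauge_zero_pos F N k hk ha u (greenK T' hpos'))
      (QOfRecord_surjective_gaugeAct_one hk u) :=
  fun f => frakGOfRecordAtBg128_pureGauge_zero_mem_constraint102 F N k Ω hk ha u T' hpos' hT' f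

end Summit.QuantumFields.YangMills.Theorems.N07FrakGSliceTokOfRecord

end
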